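import Summits.RiemannHypothesis.RiemannHypothesis.Theorems.WeilGroundStateMarkovPartPositiveGroundStateMainAux
import Summits.RiemannHypothesis.RiemannHypothesis.Theses.WeilGroundState

/-!
# Route WeilGroundState, item `MarkovPartPositiveGroundState`: proof

`Summit.RiemannHypothesis.RiemannHypothesis.Theses.WeilGroundState.MarkovPartPositiveGroundState`
(item stmt-RiemannHypothesis-1530): for every window `a > 0` the pole-removed Weil form
`Q₀(g) = Re Q(g) − 2|∫ g cosh(t/2)|² + 2|∫ g sinh(t/2)|²` has a ground state `u ∈ L²`, even, real
and `> 0` on `(-a, a)`, to which EVERY normalised `Q₀`-minimising sequence of window test functions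
converges in `L²` after fixing phases — the Perron–Frobenius half of the route's mechanism.

Proof (operator-free Perron–Frobenius for the killed pure-jump Dirichlet form
`Q₀ = 𝓔_a − M_a‖·‖²`, `weilMarkovQuadratic_eq_weilDirichletEnergy_sub`), assembled from the
support files `…Pairs`, `…Lsc`, `…Convex`, `…Positive`, `…Phase`, `…DensityAux`, `…Density`,
`…MainAux`:
1. `E = inf Q₀ + M_a` bounds `𝓔_a` below on window test functions, hence (form core,
   `bottom_mul_le_of_finiteEnergy`) on the whole finite-energy class of the window;
2. a minimiser `u₀` exists (Connes–Consani–Moscovici compactness + Fatou, `exists_markovMinimizer`);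
3. `Φ = |u₀|` is a non-negative minimiser (contraction), UNIQUE (convexity of `ρ ↦ 𝓔(√ρ)` and
   a.e. pair rigidity — the archimedean jump density charges every length), a.e. POSITIVE on the
   window (first-order deficit argument) and EVEN (reflection invariance + uniqueness); choose an
   everywhere even, everywhere positive representative;
4. given a minimising sequence `gₙ` and phases `cₙ = conj⟨gₙ,u⟩/|⟨gₙ,u⟩|`: every subsequence has
   an `L²`-convergent sub-subsequence (compactness) whose limit is a normalised finite-energy
   minimiser, hence `γu` with `|γ| = 1` (`minimizer_ae_eq_const_mul`), along which `cₙgₙ → u`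
   (`tendsto_phase_fix`); the subsequence principle concludes.

## References

* M. Reed, B. Simon, *Methods of Modern Mathematical Physics IV* (1978), §XIII.12, Thms
  XIII.43–44 (Perron–Frobenius / Jentzsch for ground states).
* E. Bombieri, Rend. Mat. Acc. Lincei (9) 11 (2000), Thm 2 and §4 (explicit formula; variational
  theory of the truncated form).
* A. Connes, C. Consani, H. Moscovici, arXiv:2511.22755, Thm 3.6 (compactness).
* M. Suzuki, arXiv:2606.09096, §5.2 (the same mechanism for the scale-free model form).
-/

-- `Summit.RiemannHypothesis.RiemannHypothesis.…` repeats the summit name by design (D-0017 layout).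
set_option linter.dupNamespace false

noncomputable section

open MeasureTheory Set Filter
open scoped Topology ENNReal NNReal ComplexConjugate

namespace Summit.RiemannHypothesis.RiemannHypothesis.Theorems

open Literature.NumberTheory.LFunctions Literature.NumberTheory.LFunctions.ConnesVanSuijlekom
open Summit.RiemannHypothesis.RiemannHypothesis.Theorems.WeilWindowFlowWindowLipschitz
open Summit.RiemannHypothesis.RiemannHypothesis.Theorems.WeilGroundStateMarkovPart

/-- **Item `MarkovPartPositiveGroundState` of route WeilGroundState (stmt-RiemannHypothesis-1530):
the pole-removed Weil form has, on every window `[-a, a]`, a positive even ground state to which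
every normalised minimising sequence of test functions converges in `L²` modulo phases.** See the
module docstring for the proof. -/
theorem markovPartPositiveGroundState_proof :
    Summit.RiemannHypothesis.RiemannHypothesis.Theses.WeilGroundState.MarkovPartPositiveGroundState := by
  classical
  intro a ha
  -- the bottom `E` of the Dirichlet energy on the window
  set S' : Set ℝ := {x : ℝ | ∃ h : ℝ → ℂ, IsWeilTest h ∧ tsupport h ⊆ Icc (-a) a ∧
    ∫ t, ‖h t‖ ^ 2 = (1 : ℝ) ∧ x = weilMarkovQuadratic h} with hS'
  set E : ℝ := sInf S' + weilMarkovConstant a with hEdef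
  have hEtest : ∀ h : ℝ → ℂ, IsWeilTest h → tsupport h ⊆ Icc (-a) a →
      E * ∫ x, ‖h x‖ ^ 2 ≤ weilDirichletEnergy a h := fun h hh hhs ↦
    bottom_mul_le_weilDirichletEnergy hh hhs
  have hbot : ∀ v : ℝ → ℂ, MemLp v 2 → (∀ x, x ∉ Icc (-a) a → v x = 0) →
      IntegrableOn (fun t ↦ weilArchDensity t * weilIncrement v t) (Ioi 0) →
      E * ∫ x, ‖v x‖ ^ 2 ≤ weilDirichletEnergy a v := fun v hv hvs hvf ↦
    bottom_mul_le_of_finiteEnergy ha hEtest hv hvs hvf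
  -- a minimiser and its modulus
  obtain ⟨u₀, hu₀, hu₀s, hu₀n, hu₀f, hu₀E⟩ := exists_markovMinimizer ha
  set v₀ : ℝ → ℂ := (Icc (-a) a).indicator (hu₀.1.mk u₀) with hv₀def
  have hv₀u : v₀ =ᵐ[volume] u₀ := by
    filter_upwards [hu₀.1.ae_eq_mk, hu₀s] with x h1 h2
    by_cases hx : x ∈ Icc (-a) a
    · rw [hv₀def, indicator_of_mem hx]; exact h1.symm
    · rw [hv₀def, indicator_of_notMem hx, h2 hx]
  have hv₀m : Measurable v₀ :=
    hu₀.1.stronglyMeasurable_mk.measurable.indicator measurableSet_Icc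
  have hv₀L : MemLp v₀ 2 := hu₀.ae_eq hv₀u.symm
  have hv₀s : ∀ x, x ∉ Icc (-a) a → v₀ x = 0 := fun x hx ↦ indicator_of_notMem hx _
  have hv₀n : ∫ x, ‖v₀ x‖ ^ 2 = 1 := by
    rw [← hu₀n]; exact integral_congr_ae (hv₀u.mono fun x hx ↦ by simp [hx])
  have hv₀fin : IntegrableOn (fun t ↦ weilArchDensity t * weilIncrement v₀ t) (Ioi 0) := by
    simp only [weilIncrement_congr_ae hv₀u]; exact hu₀f
  have hv₀E : weilDirichletEnergy a v₀ ≤ E := by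
    rw [weilDirichletEnergy_congr_ae a hv₀u]; exact hu₀E
  set Φ : ℝ → ℝ := fun x ↦ ‖v₀ x‖ with hΦdef
  have hΦm : Measurable Φ := hv₀m.norm
  have hΦ0 : ∀ x, 0 ≤ Φ x := fun x ↦ norm_nonneg _
  have hΦL : MemLp Φ 2 := hv₀L.norm
  have hΦs : ∀ x, x ∉ Icc (-a) a → Φ x = 0 := fun x hx ↦ by simp [hΦdef, hv₀s x hx]
  have hΦn : ∫ x, Φ x ^ 2 = 1 := hv₀n
  have hΦfin := finiteEnergy_norm hv₀L hv₀fin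
  have hΦE : weilDirichletEnergy a (fun x ↦ ((Φ x : ℝ) : ℂ)) ≤ E :=
    (weilDirichletEnergy_norm_le a hv₀L hv₀fin).trans hv₀E
  -- positivity, evenness, representative
  have hΦpos : ∀ᵐ x : ℝ, x ∈ Ioo (-a) a → 0 < Φ x :=
    nonneg_minimizer_ae_pos ha hΦm hΦ0 hΦL hΦs hΦn hΦfin hΦE hbot
  have hΦeven : Φ =ᵐ[volume] fun x ↦ Φ (-x) :=
    nonneg_minimizer_even hΦm hΦ0 hΦL hΦs hΦn hΦfin hΦE hbot
  obtain ⟨f, hfeven, hfpos, hfΦ⟩ := exists_even_pos_rep hΦs hΦpos hΦeven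
  have hfL : MemLp f 2 := hΦL.ae_eq hfΦ.symm
  set u : ℝ → ℂ := fun x ↦ ((f x : ℝ) : ℂ) with hudef
  have huL : MemLp u 2 := hfL.ofReal
  have hun : ∫ x, ‖u x‖ ^ 2 = 1 := by
    rw [← hΦn]
    refine integral_congr_ae (hfΦ.mono fun x hx ↦ ?_)
    simp only [hudef, Complex.norm_real, Real.norm_eq_abs, sq_abs, hx]
  refine ⟨u, huL, fun t ↦ by simp only [hudef, hfeven t], fun t ht ↦ ⟨?_, ?_⟩, ?_⟩
  · simpa only [hudef, Complex.ofReal_re] using hfpos t ht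
  · simp only [hudef, Complex.ofReal_im]
  -- the convergence of minimising sequences
  intro g hg hT
  have hgm : ∀ n, MemLp (g n) 2 := fun n ↦ (hg n).1.memLp_two
  -- energies tend to `E`
  have hQ₀ : Tendsto (fun n ↦ weilMarkovQuadratic (g n)) atTop (𝓝 (sInf S')) := by
    rw [markovSet_eq a] at hT
    exact hT.congr fun n ↦ (weilMarkovQuadratic_eq (g n)).symm
  have hEg : Tendsto (fun n ↦ weilDirichletEnergy a (g n)) atTop (𝓝 E) := by
    have e : (fun n ↦ weilDirichletEnergy a (g n)) =
        fun n ↦ weilMarkovQuadratic (g n) + weilMarkovConstant a := by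
      funext n
      rw [weilMarkovQuadratic_eq_energy_sub (hg n).1 (hg n).2.1 (hg n).2.2]
      ring
    rw [e]
    exact hQ₀.add tendsto_const_nhds
  -- the phases
  set c : ℕ → ℂ := fun n ↦ if (∫ y, g n y * conj (u y)) = 0 then (1 : ℂ)
    else conj (∫ y, g n y * conj (u y)) / (((‖∫ y, g n y * conj (u y)‖ : ℝ)) : ℂ) with hcdef
  have hcn : ∀ n, ‖c n‖ = 1 := fun n ↦ by
    simp only [hcdef]
    split_ifs with h
    · exact norm_one
    · rw [norm_div, Complex.norm_conj, Complex.norm_real, Real.norm_of_nonneg (norm_nonneg _),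
        div_self (norm_ne_zero_iff.2 h)]
  refine ⟨c, hcn, ?_⟩
  -- subsequence principle
  refine tendsto_of_subseq_tendsto fun ns hns ↦ ?_
  -- compactness along the subsequence
  have hbdd : BddAbove (Set.range fun k ↦ (weilQuadratic (g (ns k))).re) := by
    obtain ⟨B, hB⟩ := (hQ₀.comp hns).bddAbove_range
    refine ⟨B + 4 * a * Real.exp (2 * a), ?_⟩
    rintro _ ⟨k, rfl⟩
    simp only
    rw [weilQuadratic_re_eq_weilPoleForm_add]
    have h1 : weilMarkovQuadratic (g (ns k)) ≤ B := hB ⟨k, rfl⟩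
    have h2 := weilPoleForm_le_of_sphere ha (hg (ns k)).1 (hg (ns k)).2.1 (hg (ns k)).2.2
    linarith
  obtain ⟨u', hu', φ, hφ, hlim⟩ := ConnesConsaniMoscovici2025_thm_3_6_holds a ha
    (fun k ↦ g (ns k)) (fun k ↦ hg (ns k)) hbdd
  have hgm' : ∀ k, MemLp (g (ns (φ k))) 2 := fun k ↦ hgm _
  -- the limit is a normalised finite-energy minimiser, hence `γ u`
  have hu'n : ∫ x, ‖u' x‖ ^ 2 = 1 := by
    have h1 := tendsto_integral_norm_sq hu' hgm' hlim
    simp only [(hg _).2.2] at h1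
    exact (tendsto_nhds_unique tendsto_const_nhds h1).symm
  have hu's : ∀ᵐ x : ℝ, x ∉ Icc (-a) a → u' x = 0 :=
    ae_eq_zero_of_tendsto hu' hgm' (fun k x hx ↦
      image_eq_zero_of_notMem_tsupport fun h' ↦ hx ((hg (ns (φ k))).2.1 h')) hlim
  obtain ⟨hu'f, hu'E⟩ := finiteEnergy_of_tendsto (a := a) (fun k ↦ (hg (ns (φ k))).1) hu' hlim
    (hEg.comp (hns.comp hφ.tendsto_atTop))
  obtain ⟨γ, hγ, hu'γ⟩ := minimizer_ae_eq_const_mul ha hΦm hΦ0 hΦL hΦs hΦn hΦfin hΦE hbot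
    hΦpos hu' hu's hu'n hu'f hu'E
  have hlim' : Tendsto (fun k ↦ ∫ x, ‖g (ns (φ k)) x - γ * u x‖ ^ 2) atTop (𝓝 0) := by
    refine hlim.congr fun k ↦ integral_congr_ae ?_
    filter_upwards [hu'γ, hfΦ] with x h1 h2
    simp only [h1, hudef, h2]
  exact ⟨φ, tendsto_phase_fix huL hun hgm' hγ hlim'⟩

end Summit.RiemannHypothesis.RiemannHypothesis.Theorems

end
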